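import Summits.ResolutionOfSingularities.ResolutionOfSingularities.Theorems.FrobeniusLadderFInjectiveMacaulayficationTrFullStepDoor
import Literature.AlgebraicGeometry.Resolution.BlowupsLocal
import HarnessLib

/-!
# THE T-SIDE GERM CURRENCY `TStepInstanceAt p x I` — the «FULL ⇒ REGULAR» step at ONE (germ, centre), one model suffices, and the global → germ bridge
# (crux `FInjectiveMacaulayfication` stmt-ResolutionOfSingularities-15315, chain w45a, door v41 «full-to-regular door»; res-L1-w45a-plan-1 RULING R18.22 (1) «GO §A NOW» of
# this seat's typing plan `g9/E4-STEP-TYPING.md` c62c2ad19d377467; seat res-L1-w45a-stub-3 g9 over `TrFullStep` p618253)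

[OURS · L1 W4.5a] Support file (`--supports stmt-ResolutionOfSingularities-15315 --as helper`); replaces the role of NO printed item; NOT a statement of any manuscript;
ONE definition (`@[reducible] def TStepInstanceAt`, OURS, the T-side twin of res-L1-w45a-stub-1's `GermForm.FInjectivizationGermAt`; no instance, no notation, no named fact)
and plumbing theorems. AI-written (AI review is weaker than expert review).

* §1 `TStepInstanceAt p x I` := LITERALLY the inner quantifier block of v41's stub `TrFullStep.LocalRegularizationFibreFullTr p e r` at one germ `Spec 𝒪_{X,x}` and one centre `I`:
  `∀ S′ g, I ≠ ⊥ → Supp I ⊆ (Reg Spec 𝒪_{X,x})ᶜ → IsBlowup g I → (regular off the closed fibre) → (∀ s, FullCl p 𝒪_{S′,s}) → ∃ 𝓚 ≠ ⊥ fibre-supported, ∀ S″ π, IsBlowup π 𝓚 →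
  Scheme.IsRegular S″`; `tStep_iff_forall_instance` (the stub ↔ its instances at all legal (k, Y, y, I), by quantifier bookkeeping only).
* §2 ★ `tStepInstanceAt_of_model` — ONE MODEL WITH ONE REGULARISING CENTRE SUFFICES: a blowing up `π₀ : S₀ → Spec 𝒪_{X,x}` along `I`, a fibre-supported `𝓚₀ ≠ ⊥` on `S₀` and
  ONE regular blowing up `π₁ : S₁ → S₀` along `𝓚₀` give `TStepInstanceAt p x I` (any other `S′` is `≅ S₀` over the base by `IsBlowup.unique`; transport `𝓚₀` along the
  isomorphism, `IsBlowup.comp_iso`, uniqueness again).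
* §3 ★ `tStepInstanceAt_of_isBlowup` — GLOBAL → GERM: a blowing up `π₁ : X₁ → X` along `J`, an ideal sheaf `𝓚 ≠ ⊥`-on-the-germ on `X₁` supported over `x`, and a blowing up
  `π₂ : X₂ → X₁` along `𝓚` regular over the generizations of `x` ⇒ `TStepInstanceAt p x (J·𝒪_{X,x})` (flat pull-backs along `X.fromSpecStalk x`, as
  `GermOfGlobalBlowup.fInjectivizationGermAt_of_isBlowup`). This is the interface the E4″ instance rows (first: (G, 𝔪) of `g9/E4-STEP.md`) will use.
[folklore plumbing; cite: GortzWedhorn2020, (13.19), Prop. 13.91 (2)] [cite: Temkin2008, §2.1]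
-/

-- single-problem summit: the doubled namespace component is forced
set_option linter.dupNamespace false

noncomputable section

namespace Summit.ResolutionOfSingularities.ResolutionOfSingularities.Theorems.FInjectiveMacaulayfication.TStepGerm

open CategoryTheory CategoryTheory.Limits AlgebraicGeometry TopologicalSpace IsLocalRing
open Literature.AlgebraicGeometry.Resolution
open Summit.ResolutionOfSingularities.ResolutionOfSingularities.Theorems.FInjectiveMacaulayfication
open SliceableCentre TrFullStep

/-! ## §1 The currency -/

/-- **`TStepInstanceAt p x I` — the «FULL ⇒ REGULAR» step at ONE germ `Spec 𝒪_{X,x}` and ONE centre `I`**: literally the inner quantifier block of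
`TrFullStep.LocalRegularizationFibreFullTr` — for every blowing up `g : S′ → Spec 𝒪_{X,x}` along `I` (`I ≠ ⊥`, admissible), regular off the closed fibre and FULL at every
stalk, there is `𝓚 ≠ ⊥` on `S′` supported over the closed point all of whose blowings up are regular. The T-side twin of `GermForm.FInjectivizationGermAt`.
[folklore; OURS abbreviation of the v41 stub's body] -/
@[reducible] def TStepInstanceAt (p : ℕ) {X : Scheme.{0}} (x : X) (I : (Spec (X.presheaf.stalk x)).IdealSheafData) : Prop :=
  ∀ (S' : Scheme.{0}) (g : S' ⟶ Spec (X.presheaf.stalk x)),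
    I ≠ ⊥ → ((I.support : Set _) ⊆ (Scheme.regularLocus (Spec (X.presheaf.stalk x)))ᶜ) → IsBlowup g I →
    (∀ s : S', g.base s ≠ closedPoint (X.presheaf.stalk x) → s ∈ Scheme.regularLocus S') →
    (∀ s : S', FullCl p (S'.presheaf.stalk s)) →
    ∃ 𝓚 : S'.IdealSheafData, 𝓚 ≠ ⊥ ∧ (∀ s ∈ (𝓚.support : Set S'), g.base s = closedPoint (X.presheaf.stalk x)) ∧
      ∀ (S'' : Scheme.{0}) (π : S'' ⟶ S'), IsBlowup π 𝓚 → Scheme.IsRegular S''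

/-- **The v41 stub ↔ its instances**: `LocalRegularizationFibreFullTr p e r` iff `TStepInstanceAt p y I` at every closed singular FULL point `y` of every legal `e`-fold over
`k(X₁,…,X_r)` and every centre `I` (quantifier bookkeeping only). [plumbing] -/
theorem tStep_iff_forall_instance {p e r : ℕ} :
    LocalRegularizationFibreFullTr p e r ↔
      ∀ (k : Type) [Field k] [CharP k p] (Y : Scheme.{0}) (g : Y ⟶ Spec (.of (FractionRing (MvPolynomial (Fin r) k)))),
        IsSeparated g → LocallyOfFiniteType g → QuasiCompact g → IsIntegral Y → topologicalKrullDim Y = e →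
        ∀ y : Y, IsClosed ({y} : Set Y) → y ∉ Scheme.regularLocus Y → FullCl p (Y.presheaf.stalk y) →
          ∀ I : (Spec (Y.presheaf.stalk y)).IdealSheafData, TStepInstanceAt p y I :=
  ⟨fun h k _ _ Y g hs hl hq hi hd y hy hys hyf I S' g' hI hIadm hg' hreg hfull => h k Y g hs hl hq hi hd y hy hys hyf S' g' I hI hIadm hg' hreg hfull,
    fun h k _ _ Y g hs hl hq hi hd y hy hys hyf S' g' I hI hIadm hg' hreg hfull => h k Y g hs hl hq hi hd y hy hys hyf I S' g' hI hIadm hg' hreg hfull⟩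

/-! ## §2 One model with one regularising centre suffices -/

/-- ★ **ONE MODEL SUFFICES.** If `π₀ : S₀ → Spec 𝒪_{X,x}` is a blowing up along `I`, `𝓚₀ ≠ ⊥` is an ideal sheaf on `S₀` supported over the closed point, and `π₁ : S₁ → S₀` is a
blowing up along `𝓚₀` with `S₁` regular, then `TStepInstanceAt p x I` (for every other blowing up `g : S′ → Spec 𝒪_{X,x}` along `I`, `IsBlowup.unique` gives `e : S′ ≅ S₀` over the
base; `𝓚 := e^* 𝓚₀`; a blowing up of `S′` along `𝓚` followed by `e` is a blowing up of `S₀` along `𝓚₀` (`IsBlowup.comp_iso`), hence `≅ S₁`, hence regular). The FULL and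
regular-off-the-fibre hypotheses of the instance are not even used. [folklore; cite: GortzWedhorn2020, (13.19)] -/
theorem tStepInstanceAt_of_model (p : ℕ) {X : Scheme.{0}} (x : X) {I : (Spec (X.presheaf.stalk x)).IdealSheafData}
    {S₀ : Scheme.{0}} {π₀ : S₀ ⟶ Spec (X.presheaf.stalk x)} (hπ₀ : IsBlowup π₀ I)
    (𝓚₀ : S₀.IdealSheafData) (h𝓚₀ : 𝓚₀ ≠ ⊥) (hsupp₀ : ∀ s ∈ (𝓚₀.support : Set S₀), π₀.base s = closedPoint (X.presheaf.stalk x))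
    {S₁ : Scheme.{0}} {π₁ : S₁ ⟶ S₀} (hπ₁ : IsBlowup π₁ 𝓚₀) (hreg₁ : Scheme.IsRegular S₁) :
    TStepInstanceAt p x I := by
  intro S' g _ _ hg _ _
  obtain ⟨e, he, -⟩ := hg.unique hπ₀
  refine ⟨𝓚₀.comap e.hom, ?_, ?_, ?_⟩
  · intro h0
    apply h𝓚₀
    have : 𝓚₀ = (𝓚₀.comap e.hom).comap e.inv := by
      rw [← Scheme.IdealSheafData.comap_comp, e.inv_hom_id, Scheme.IdealSheafData.comap_id]
    rw [this, h0, Scheme.IdealSheafData.comap_bot]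
  · intro s hs
    rw [Scheme.IdealSheafData.support_comap] at hs
    have h1 := hsupp₀ _ hs
    rwa [← Scheme.Hom.comp_apply, he] at h1
  · intro S'' π hπ t
    have hπ' : IsBlowup (π ≫ e.hom) 𝓚₀ := by
      have h := hπ.comp_iso e
      rwa [← Scheme.IdealSheafData.comap_comp, e.inv_hom_id, Scheme.IdealSheafData.comap_id] at h
    obtain ⟨e₁, -, -⟩ := hπ'.unique hπ₁
    exact (Scheme.mem_regularLocus t).mp ((mem_regularLocus_iff_of_flat_of_isPreimmersion e₁.hom t).mpr (hreg₁ _))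

/-! ## §3 The global → germ bridge -/

/-- ★ **GLOBAL → GERM.** Let `π₁ : X₁ → X` be a blowing up along `J`, `𝓚 : X₁.IdealSheafData` with `𝓚·𝒪_{X₁ ×_X Spec 𝒪_{X,x}} ≠ ⊥` and every point of `Supp 𝓚` over a
generization of `x` lying over `x` itself, and `π₂ : X₂ → X₁` a blowing up along `𝓚` with `X₂` regular at every point over a generization of `x`. Then
`TStepInstanceAt p x (J·𝒪_{X,x})`: the model is the flat pull-back `X₁ ×_X Spec 𝒪_{X,x}` (a blowing up along `J·𝒪_{X,x}`), the centre `𝓚` pulled back, its blowing up the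
flat pull-back of `π₂` (regular by the pro-open stalk isomorphisms); then §2. [folklore; cite: GortzWedhorn2020, Prop. 13.91 (2); Temkin2008, §2.1] -/
theorem tStepInstanceAt_of_isBlowup (p : ℕ) {X X₁ X₂ : Scheme.{0}} (x : X) {π₁ : X₁ ⟶ X} {J : X.IdealSheafData} (hπ₁ : IsBlowup π₁ J)
    (𝓚 : X₁.IdealSheafData) (h𝓚 : 𝓚.comap (pullback.fst π₁ (X.fromSpecStalk x)) ≠ ⊥)
    (hsupp : ∀ x₁ ∈ (𝓚.support : Set X₁), π₁.base x₁ ⤳ x → π₁.base x₁ = x)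
    {π₂ : X₂ ⟶ X₁} (hπ₂ : IsBlowup π₂ 𝓚) (hreg : ∀ x₂ : X₂, (π₂ ≫ π₁).base x₂ ⤳ x → x₂ ∈ Scheme.regularLocus X₂) :
    TStepInstanceAt p x (J.comap (X.fromSpecStalk x)) := by
  haveI : Flat (X.fromSpecStalk x) := flat_fromSpecStalk X x
  -- floor 1: the flat pull-back `P₁ = X₁ ×_X Spec 𝒪_{X,x}`, a blowing up along `J·𝒪_{X,x}`
  have hP₁ : IsBlowup (pullback.snd π₁ (X.fromSpecStalk x)) (J.comap (X.fromSpecStalk x)) := hπ₁.pullback_snd_of_flat (X.fromSpecStalk x)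
  have hfj : ∀ s : ↑(pullback π₁ (X.fromSpecStalk x)),
      π₁.base (pullback.fst π₁ (X.fromSpecStalk x) s) = X.fromSpecStalk x (pullback.snd π₁ (X.fromSpecStalk x) s) := fun s => by
    rw [← Scheme.Hom.comp_apply, pullback.condition, Scheme.Hom.comp_apply]
  -- floor 2: the flat pull-back of `π₂` along `P₁ → X₁`, a blowing up along `𝓚·𝒪_{P₁}`
  have hP₂ : IsBlowup (pullback.snd π₂ (pullback.fst π₁ (X.fromSpecStalk x))) (𝓚.comap (pullback.fst π₁ (X.fromSpecStalk x))) :=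
    hπ₂.pullback_snd_of_flat _
  refine tStepInstanceAt_of_model p x hP₁ (𝓚.comap (pullback.fst π₁ (X.fromSpecStalk x))) h𝓚 ?_ hP₂ ?_
  · -- the pulled-back centre is supported over the closed point
    intro s hs
    rw [Scheme.IdealSheafData.support_comap] at hs
    have hgen : π₁.base (pullback.fst π₁ (X.fromSpecStalk x) s) ⤳ x := by
      have := Set.mem_range_self (f := pullback.fst π₁ (X.fromSpecStalk x)) s
      rw [range_pullback_fst_fromSpecStalk] at this
      exact this
    have h1 : π₁.base (pullback.fst π₁ (X.fromSpecStalk x) s) = x := hsupp _ hs hgen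
    apply (X.fromSpecStalk x).isEmbedding.injective
    rw [← hfj s, h1, Scheme.fromSpecStalk_closedPoint]
  · -- the pulled-back floor 2 is regular: its points sit over generizations of `x`, pro-open stalk isomorphisms
    intro t
    have ht : (pullback.fst π₂ (pullback.fst π₁ (X.fromSpecStalk x)) t) ∈ Scheme.regularLocus X₂ := by
      apply hreg
      have h1 : (π₂ ≫ π₁).base (pullback.fst π₂ (pullback.fst π₁ (X.fromSpecStalk x)) t) =
          π₁.base (pullback.fst π₁ (X.fromSpecStalk x) (pullback.snd π₂ (pullback.fst π₁ (X.fromSpecStalk x)) t)) := by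
        rw [Scheme.Hom.comp_apply]
        congr 1
        rw [← Scheme.Hom.comp_apply, pullback.condition, Scheme.Hom.comp_apply]
      rw [h1]
      have := Set.mem_range_self (f := pullback.fst π₁ (X.fromSpecStalk x)) (pullback.snd π₂ (pullback.fst π₁ (X.fromSpecStalk x)) t)
      rw [range_pullback_fst_fromSpecStalk] at this
      exact this
    exact (Scheme.mem_regularLocus t).mp ((mem_regularLocus_iff_of_flat_of_isPreimmersion _ t).mpr ht)

end Summit.ResolutionOfSingularities.ResolutionOfSingularities.Theorems.FInjectiveMacaulayfication.TStepGerm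

end
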